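import Literature.MathematicalPhysics.QuantumLattice.DWaveSourceNNNHoppingOrderParameter
import HarnessLib

/-!
# Vanishing-source schedules under-estimate the Koma–Tasaki `d`-wave order parameter
# (the fixed-`c` diagonal reading rule)

Topic `MathematicalPhysics/QuantumLattice` (family `hubbard`). A short section over the objects of
`PinningFieldPairingOrder.lean` (`dWaveSourceDensityTT' L t' U μ h` = the sourced finite-torus `d`-wave density,
`dWaveOrderParameterTT' t' U μ = liminf_{h↓0} liminf_L …`, `HasDWaveOrderTT'`) and the levers of
`DWaveSourceNNNHoppingOrderParameter.lean` (`dWaveSourceDensityTT'_mono`, `dWaveSourceDensityTT'_nonneg`,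
`dWaveSourceDensityTT'_le_const`, `le_dWaveOrderParameterTT'_of_forall`); written for cell `hubbard-floor`
(D-0160, FQ2 pre-registration: finite tori read along fixed-`c` diagonals `h_L · |Λ_L| = c`). All statements are
PROVED; no definition, no named fact, no `sorry`.

THE READING RULE. Along ANY non-negative source schedule `h_L → 0` — in particular the fixed-`c` diagonal
`h_L = c / (L+1)²` of the `(L+1) × (L+1)` torus — the `L`-liminf of the finite-volume sourced densities is a FLOOR
under the order parameter:

  `liminf_L dWaveSourceDensityTT' (L+1) t' U μ (h_L) ≤ dWaveOrderParameterTT' t' U μ`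
  (`liminf_schedule_le_dWaveOrderParameterTT'`, `liminf_fixedC_diagonal_le_dWaveOrderParameterTT'`; the
calculus fact that the diagonal vanishes is the private helper `tendsto_fixedC_diagonal`).

Hence an `L`-uniform positive floor along one diagonal proves `HasDWaveOrderTT'`
(`hasDWaveOrderTT'_of_liminf_schedule_pos`, `hasDWaveOrderTT'_of_liminf_fixedC_diagonal_pos`, eventual form
`le_dWaveOrderParameterTT'_of_eventually_le_schedule`), and `dWaveOrderParameterTT' = 0` forces every diagonal
liminf to vanish (`liminf_schedule_nonpos_of_dWaveOrderParameterTT'_eq_zero`). The proof is Griffiths'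
monotonicity in the source at fixed volume (`h_L ≤ h` eventually, for each fixed `h > 0`) followed by the lower
lever (the order parameter is the infimum over `h > 0` of its volume-`liminf` stairs, Koma–Tasaki 1994 §1). No
converse holds: a diagonal whose `c` lies below the tower scale reads `0` in an ordered phase too (Koma–Tasaki 1994
§1, the obscured-symmetry-breaking discussion), so the rule never turns a vanishing diagonal into absence of order.

Words discipline (cell hubbard-floor, BRIEF v1.1): this is a reading rule for certified finite-torus rows
(`m(h) ∈ [m⁻, m⁺] at h = …, CERTIFIED(KERNEL)`); it licenses no statement about onset, gap or order from
finite-`h`, finite-`L` data. Nothing here asserts order or its absence at any `(t', U, μ)`; superconductivity in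
the Hubbard model is not proved by anything here. Tree search: `lean search --decl
'liminf_schedule|fixedC_diagonal|of_eventually_le_schedule'` — nothing; the nearest tree statements are the
fixed-`h` levers `dWaveOrderParameterTT'_le_liminf` / `le_dWaveOrderParameterTT'_of_forall` (no schedules).

References: T. Koma, H. Tasaki, J. Stat. Phys. 76 (1994) 745, §1 [cite: KomaTasaki1994, §1]; R. B. Griffiths,
Phys. Rev. 152 (1966) 240 (monotonicity of the sourced order in the source) [cite: Griffiths1966, §II].
-/

noncomputable section

namespace Literature.MathematicalPhysics.QuantumLattice

open Finset Literature.Probability.LatticeModels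
open _root_.Filter
open scoped _root_.Topology

/-- **Schedule under-estimate.** For every non-negative source schedule `h_L → 0`,
`liminf_L dWaveSourceDensityTT' (L+1) t' U μ (h_L) ≤ dWaveOrderParameterTT' t' U μ`.
[cite: KomaTasaki1994, §1] [cite: Griffiths1966, §II] -/
theorem liminf_schedule_le_dWaveOrderParameterTT' (t' U μ : ℝ) {hL : ℕ → ℝ}
    (h0 : ∀ L, 0 ≤ hL L) (hlim : Tendsto hL atTop (𝓝 0)) :
    liminf (fun L : ℕ => dWaveSourceDensityTT' (L + 1) t' U μ (hL L)) atTop ≤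
      dWaveOrderParameterTT' t' U μ := by
  refine le_dWaveOrderParameterTT'_of_forall t' U μ zero_lt_one fun h hh => ?_
  have hev : ∀ᶠ L in atTop, hL L ≤ h := hlim.eventually (eventually_le_nhds hh.1)
  refine liminf_le_liminf ?_ ?_ ?_
  · filter_upwards [hev] with L hL' using dWaveSourceDensityTT'_mono t' U μ hL'
  · exact isBoundedUnder_of_eventually_ge (a := 0)
      (Eventually.of_forall fun L => dWaveSourceDensityTT'_nonneg t' U μ (h0 L))
  · exact isCoboundedUnder_ge_of_eventually_le atTop
      (x := 2 * ∑ e ∈ insert (0 : Site 2) unitSteps, |dWaveFormFactor e / Real.sqrt 2|)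
      (Eventually.of_forall fun L => dWaveSourceDensityTT'_le_const _ t' U μ h)

/-- **Order form.** An `L`-uniform positive floor along one vanishing non-negative schedule proves
Koma–Tasaki `d`-wave order `HasDWaveOrderTT' t' U μ`. [cite: KomaTasaki1994, §1] -/
theorem hasDWaveOrderTT'_of_liminf_schedule_pos (t' U μ : ℝ) {hL : ℕ → ℝ}
    (h0 : ∀ L, 0 ≤ hL L) (hlim : Tendsto hL atTop (𝓝 0))
    (hpos : 0 < liminf (fun L : ℕ => dWaveSourceDensityTT' (L + 1) t' U μ (hL L)) atTop) :
    HasDWaveOrderTT' t' U μ :=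
  lt_of_lt_of_le hpos (liminf_schedule_le_dWaveOrderParameterTT' t' U μ h0 hlim)

/-- **Contrapositive form.** If the order parameter vanishes, every vanishing non-negative schedule has
diagonal liminf `≤ 0` (hence `= 0`, the densities being non-negative). [cite: KomaTasaki1994, §1] -/
theorem liminf_schedule_nonpos_of_dWaveOrderParameterTT'_eq_zero (t' U μ : ℝ) {hL : ℕ → ℝ}
    (h0 : ∀ L, 0 ≤ hL L) (hlim : Tendsto hL atTop (𝓝 0))
    (hzero : dWaveOrderParameterTT' t' U μ = 0) :
    liminf (fun L : ℕ => dWaveSourceDensityTT' (L + 1) t' U μ (hL L)) atTop ≤ 0 :=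
  hzero ▸ liminf_schedule_le_dWaveOrderParameterTT' t' U μ h0 hlim

/-- The fixed-`c` diagonal `h_L = c/(L+1)²` (`h_L · |Λ_{L+1}| = c`) is a vanishing non-negative schedule
(calculus plumbing). [folklore] -/
private theorem tendsto_fixedC_diagonal (c : ℝ) :
    Tendsto (fun L : ℕ => c / ((L : ℝ) + 1) ^ 2) atTop (𝓝 0) := by
  have h1 : Tendsto (fun L : ℕ => (L : ℝ) + 1) atTop atTop :=
    tendsto_natCast_atTop_atTop.atTop_add tendsto_const_nhds
  have h2 : Tendsto (fun L : ℕ => ((L : ℝ) + 1) ^ 2) atTop atTop :=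
    (tendsto_pow_atTop two_ne_zero).comp h1
  exact tendsto_const_nhds.div_atTop h2

/-- **The fixed-`c` diagonal** (the FQ2 statistic): for `c ≥ 0`,
`liminf_L m_{L+1}(c/(L+1)²) ≤ dWaveOrderParameterTT' t' U μ`. [cite: KomaTasaki1994, §1] -/
theorem liminf_fixedC_diagonal_le_dWaveOrderParameterTT' (t' U μ : ℝ) {c : ℝ} (hc : 0 ≤ c) :
    liminf (fun L : ℕ => dWaveSourceDensityTT' (L + 1) t' U μ (c / ((L : ℝ) + 1) ^ 2)) atTop ≤
      dWaveOrderParameterTT' t' U μ :=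
  liminf_schedule_le_dWaveOrderParameterTT' t' U μ (fun L => by positivity) (tendsto_fixedC_diagonal c)

/-- **FQ2 reading rule.** A positive `L`-uniform floor on the fixed-`c` diagonal densities proves
`HasDWaveOrderTT' t' U μ`. [cite: KomaTasaki1994, §1] -/
theorem hasDWaveOrderTT'_of_liminf_fixedC_diagonal_pos (t' U μ : ℝ) {c : ℝ} (hc : 0 ≤ c)
    (hpos : 0 < liminf (fun L : ℕ => dWaveSourceDensityTT' (L + 1) t' U μ (c / ((L : ℝ) + 1) ^ 2)) atTop) :
    HasDWaveOrderTT' t' U μ :=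
  lt_of_lt_of_le hpos (liminf_fixedC_diagonal_le_dWaveOrderParameterTT' t' U μ hc)

/-- **Eventual form** (the shape a certified `∀ L ≥ L₀` row takes): if `ε ≤ m_{L+1}(h_L)` for all large `L`
along a vanishing non-negative schedule, then `ε ≤ dWaveOrderParameterTT' t' U μ`.
[cite: KomaTasaki1994, §1] [cite: Griffiths1966, §II] -/
theorem le_dWaveOrderParameterTT'_of_eventually_le_schedule (t' U μ : ℝ) {hL : ℕ → ℝ} {ε : ℝ}
    (h0 : ∀ L, 0 ≤ hL L) (hlim : Tendsto hL atTop (𝓝 0))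
    (hε : ∀ᶠ L in atTop, ε ≤ dWaveSourceDensityTT' (L + 1) t' U μ (hL L)) :
    ε ≤ dWaveOrderParameterTT' t' U μ := by
  refine le_trans ?_ (liminf_schedule_le_dWaveOrderParameterTT' t' U μ h0 hlim)
  refine le_liminf_of_le ?_ hε
  exact isCoboundedUnder_ge_of_eventually_le atTop
      (x := 2 * ∑ e ∈ insert (0 : Site 2) unitSteps, |dWaveFormFactor e / Real.sqrt 2|)
      (Eventually.of_forall fun L => dWaveSourceDensityTT'_le_const _ t' U μ (hL L))

end Literature.MathematicalPhysics.QuantumLattice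

end
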